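import Literature.Barriers.NavierStokesRegularity.NavierStokesInequalitySwitchingPieces
import Literature.Barriers.NavierStokesRegularity.SchefferSwitchedField
import HarnessLib

/-!
# Scheffer's switching construction: the two vendored spellings of the pieces coincide

Barrier catalogue support file for `NavierStokesRegularity` (D-0021). The rescaled pieces
`u^{(j)}(x,t) = τ^{-j} u(Γ^{-j}x, τ^{-2j}(t - t_j))` and the glued field `𝔲` of Ożański's
switching argument (arXiv:1709.00602, §2, (2.4); Scheffer 1985, proof of Lemma 2.3) were vendored
twice, minutes apart, by two parallel sessions:

* `nsiPiece T τ z u j`, `nsiGlued T τ z u` (`NavierStokesInequalitySwitchingPieces.lean`), with the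
  inverse similarity written as `Γ^{-j}(x) = τ^{-j}(x - c_j)`, `c_j = switchShift τ z j = Γʲ(0)`;
* `Scheffer.piece T τ z u j`, `Scheffer.glue T τ z u` (`SchefferSwitchedField.lean`), with
  `Γ^{-j}(x) = x₀ + τ^{-j}(x - x₀)`, `x₀ = z/(1-τ)` the centre of `Γ`,

the analytic development (`SchefferSwitchedPieces`, `SchefferSwitchedStrips`, …) being built on
the second spelling. This bridge file proves that the two spellings define THE SAME functions
(`switchShift_eq_center_sub`, `nsiPiece_eq_piece`, `nsiGlued_eq_glue`), so that every statement
about `Scheffer.piece`/`Scheffer.glue` transports verbatim to `nsiPiece`/`nsiGlued` and nothing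
needs to be proved twice (review ruling on p22185).

## References

* W. S. Ożański, *On weak solutions to the Navier–Stokes inequality with internal
  singularities*, arXiv:1709.00602 (2017), §2 (2.4). [`Ozanski2017NSISingular`]
* V. Scheffer, Comm. Math. Phys. 101 (1985), proof of Lemma 2.3 (p. 56). [`Scheffer1985`]
-/

noncomputable section

open Set Function

namespace Literature.Barriers.NavierStokesRegularity

variable {T τ : ℝ} {z : EuclideanSpace ℝ (Fin 3)}
  {u : ℝ → EuclideanSpace ℝ (Fin 3) → EuclideanSpace ℝ (Fin 3)}

/-- **The shift is `c_j = x₀ - τʲx₀`**, `x₀ = z/(1-τ)` (both are `Γʲ(0)`; `τ ≠ 1`).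
[cite: Ozanski2017NSISingular, §2 (2.4)] -/
theorem switchShift_eq_center_sub (hτ : τ ≠ 1) (z : EuclideanSpace ℝ (Fin 3)) (j : ℕ) :
    switchShift τ z j = (1 - τ)⁻¹ • z - τ ^ j • ((1 - τ)⁻¹ • z) := by
  have h1 := iterate_affine_apply τ z j 0
  have h2 := Scheffer.similarity_iterate_eq hτ z (0 : EuclideanSpace ℝ (Fin 3)) j
  rw [smul_zero, zero_add] at h1
  rw [zero_sub, smul_neg, ← sub_eq_add_neg] at h2
  rw [← h1, h2]

/-- **The two vendored spellings of the rescaled pieces coincide**: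
`nsiPiece T τ z u j = Scheffer.piece T τ z u j` (`τ ≠ 0, 1`), since
`τ^{-j}(x - c_j) = x₀ + τ^{-j}(x - x₀)`. [cite: Ozanski2017NSISingular, §2 (2.4)] -/
theorem nsiPiece_eq_piece (hτ₀ : τ ≠ 0) (hτ₁ : τ ≠ 1) (T : ℝ) (z : EuclideanSpace ℝ (Fin 3))
    (u : ℝ → EuclideanSpace ℝ (Fin 3) → EuclideanSpace ℝ (Fin 3)) (j : ℕ) :
    nsiPiece T τ z u j = Scheffer.piece T τ z u j := by
  funext t x
  rw [nsiPiece_apply, Scheffer.piece_apply, switchShift_eq_center_sub hτ₁ z j]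
  congr 2
  have hk : (τ⁻¹) ^ j * τ ^ j = 1 := by rw [← mul_pow, inv_mul_cancel₀ hτ₀, one_pow]
  rw [← sub_add, smul_add, smul_smul, hk, one_smul, add_comm]

/-- **The two vendored spellings of the glued field coincide**:
`nsiGlued T τ z u = Scheffer.glue T τ z u` (`T > 0`, `0 < τ < 1`).
[cite: Ozanski2017NSISingular, §2 (2.4)] -/
theorem nsiGlued_eq_glue (hT : 0 < T) (hτ₀ : 0 < τ) (hτ₁ : τ < 1)
    (z : EuclideanSpace ℝ (Fin 3)) (u : ℝ → EuclideanSpace ℝ (Fin 3) → EuclideanSpace ℝ (Fin 3)) :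
    nsiGlued T τ z u = Scheffer.glue T τ z u := by
  funext t
  by_cases ht0 : t < 0
  · rw [nsiGlued_eq_zero_of_neg ht0, Scheffer.glue_eq_zero_of_neg hT hτ₀ z u ht0]
  by_cases htT : blowupTime T τ ≤ t
  · rw [nsiGlued_eq_zero_of_le htT, Scheffer.glue_eq_zero_of_le hT hτ₀ hτ₁ z u htT]
  have hmem := switchIndex_spec (T := T) hτ₀.le hτ₁ (not_lt.1 ht0) (not_le.1 htT)
  rw [nsiGlued_eq_nsiPiece hT hτ₀ hτ₁ hmem, Scheffer.glue_eq_piece hT hτ₀ z u hmem,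
    nsiPiece_eq_piece hτ₀.ne' hτ₁.ne]

/-- For a block, the pieces in the two spellings coincide. [folklore] -/
theorem IsNSIBlock.nsiPiece_eq_piece {ν₀ : ℝ} {G : Set (EuclideanSpace ℝ (Fin 3))}
    (h : IsNSIBlock T ν₀ τ z G u) (j : ℕ) : nsiPiece T τ z u j = Scheffer.piece T τ z u j :=
  Literature.Barriers.NavierStokesRegularity.nsiPiece_eq_piece h.τ_pos.ne' h.τ_lt_one.ne T z u j

/-- For a block, the glued fields in the two spellings coincide. [folklore] -/
theorem IsNSIBlock.nsiGlued_eq_glue {ν₀ : ℝ} {G : Set (EuclideanSpace ℝ (Fin 3))}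
    (h : IsNSIBlock T ν₀ τ z G u) : nsiGlued T τ z u = Scheffer.glue T τ z u :=
  Literature.Barriers.NavierStokesRegularity.nsiGlued_eq_glue h.T_pos h.τ_pos h.τ_lt_one z u

end Literature.Barriers.NavierStokesRegularity

end
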